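import Literature.Computability.AlgebraicComplexity.FSV18OccurTopFanIn
import HarnessLib

/-!
# The seed layout of FSV Thm. 48 / [ASSS16] §4: the block slots are injective and pairwise fresh
# — proofs only (val-lit p2 g3; N1 occur push, plumbing for plan step F4; lead-np GO 18:53Z)

FSV Construction 46 / Thm. 48 (`FSV2018_thm48`, `FSV2018_thm48_topFanIn`) lay the seed variables
out as `(Fin B × (Fin R ⊕ Unit)) ⊕ τ`: block `ℓ : Fin B` (`B = D − 2`) owns the Vandermonde seeds
`y_{j,ℓ} = inl (ℓ, inl j)` (`j < R`, of which `r ℓ ≤ R` are used) and `t_ℓ = inl (ℓ, inr ())`, and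
the sparse-hitting map `Φ` lives on `inr τ`; block `ℓ` is plugged in through the slot map
`v ↦ inl (ℓ, Sum.map (Fin.castLE _) id v)` on `Fin (r ℓ) ⊕ Unit` ("where
`{y_{1,ℓ}, ⋯, y_{r_ℓ,ℓ}, t_ℓ}` is a fresh set of variables", [ASSS16] Cor. 4.3). This file records
the two facts the lifting step `ASSS16.descentFaithful` (`ASSS16DescentFaithful.lean`) asks of a
block: the slot map is injective (`slot_injective`), and nothing renamed into ANOTHER block or into
the `Φ`-part touches it (`not_mem_range_slot_of_mem_vars_rename_slot`,
`not_mem_range_slot_of_mem_vars_rename_inr`, `stage_fresh`, `stage_fresh_filter`), plus the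
bookkeeping of the keystone's stage sums `Σ_{ℓ : Fin B, j ≤ ℓ} block_ℓ` (val-lit t18's `stageGen j`):
peeling off block `j` (`sum_filter_le_eq_add_sum_filter_succ_le`), the empty stage past the last
block (`sum_filter_le_eq_zero`) and the full generator at `j = 0` (`sum_filter_zero_le`).
No definitions (the slot map is written as the literal lambda of `FSV2018_thm48_topFanIn`), no
named facts. Honest framing: bookkeeping; nothing here bears on `VP ≠ VNP`.

## References
* [AgrawalEtAl2011] arXiv:1111.0582 §4 Cor. 4.3 ("a fresh set of variables"), locator
  paper:arxiv-1111.0582 p0010.txt:L41–L46.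
* [ForbesShpilkaVolk2018] Construction 46 / Thm. 48 (seq.; = ToC Constr. 5.22 / Thm. 5.24) — the
  seed layout.
-/

noncomputable section

namespace Literature.Computability.AlgebraicComplexity

namespace ASSS16

open MvPolynomial Finset

variable {F : Type*} [CommSemiring F] {B R : ℕ} {τ : Type*}

/-- **The slot map of block `ℓ` is injective** ("a fresh set of variables
`{y_{1,ℓ}, ⋯, y_{r_ℓ,ℓ}, t_ℓ}`"). [cite: AgrawalEtAl2011, Cor. 4.3; ForbesShpilkaVolk2018, Construction 46 (seq.) = ToC Constr. 5.22]
locator: paper:arxiv-1111.0582 p0010.txt:L41–L46 -/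
theorem slot_injective (ℓ : Fin B) {r : ℕ} (h : r ≤ R) :
    Function.Injective (fun v : Fin r ⊕ Unit =>
      (Sum.inl (ℓ, Sum.map (Fin.castLE h) id v) : (Fin B × (Fin R ⊕ Unit)) ⊕ τ)) := by
  intro v w hvw
  have h1 := (Prod.mk.inj (Sum.inl.inj hvw)).2
  exact (Sum.map_injective.2 ⟨Fin.castLE_injective h, fun _ _ h => h⟩) h1

/-- A seed in the range of the slot map of block `ℓ` lies in block `ℓ`.
[cite: AgrawalEtAl2011, Cor. 4.3] locator: paper:arxiv-1111.0582 p0010.txt:L41–L46 -/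
theorem exists_eq_inl_of_mem_range_slot (ℓ : Fin B) {r : ℕ} (h : r ≤ R)
    {w : (Fin B × (Fin R ⊕ Unit)) ⊕ τ}
    (hw : w ∈ Set.range (fun v : Fin r ⊕ Unit =>
      (Sum.inl (ℓ, Sum.map (Fin.castLE h) id v) : (Fin B × (Fin R ⊕ Unit)) ⊕ τ))) :
    ∃ x : Fin R ⊕ Unit, w = Sum.inl (ℓ, x) := by
  obtain ⟨v, rfl⟩ := hw
  exact ⟨_, rfl⟩

/-- **Blocks are pairwise fresh:** a seed of a polynomial renamed into block `ℓ'` is not in the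
slot of a different block `ℓ`. [cite: AgrawalEtAl2011, Cor. 4.3 ("a fresh set of variables")]
locator: paper:arxiv-1111.0582 p0010.txt:L41–L46 -/
theorem not_mem_range_slot_of_mem_vars_rename_slot (ℓ ℓ' : Fin B) (hne : ℓ' ≠ ℓ) {r r' : ℕ}
    (h : r ≤ R) (h' : r' ≤ R) (p : MvPolynomial (Fin r' ⊕ Unit) F)
    {w : (Fin B × (Fin R ⊕ Unit)) ⊕ τ}
    (hw : w ∈ (rename (fun v : Fin r' ⊕ Unit =>
      (Sum.inl (ℓ', Sum.map (Fin.castLE h') id v) : (Fin B × (Fin R ⊕ Unit)) ⊕ τ)) p).vars) :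
    w ∉ Set.range (fun v : Fin r ⊕ Unit =>
      (Sum.inl (ℓ, Sum.map (Fin.castLE h) id v) : (Fin B × (Fin R ⊕ Unit)) ⊕ τ)) := by
  classical
  intro hmem
  obtain ⟨x, rfl⟩ := exists_eq_inl_of_mem_range_slot ℓ h hmem
  obtain ⟨v, -, hv⟩ := Finset.mem_image.1 (vars_rename _ _ hw)
  exact hne (Prod.mk.inj (Sum.inl.inj hv)).1

/-- **The `Φ`-part is fresh for every block:** a seed of a polynomial renamed along `Sum.inr` is in
no slot. [cite: AgrawalEtAl2011, Cor. 4.3 ("a fresh set of variables"); ForbesShpilkaVolk2018, Construction 46 (seq.) = ToC Constr. 5.22]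
locator: paper:arxiv-1111.0582 p0010.txt:L41–L46 -/
theorem not_mem_range_slot_of_mem_vars_rename_inr (ℓ : Fin B) {r : ℕ} (h : r ≤ R)
    (q : MvPolynomial τ F) {w : (Fin B × (Fin R ⊕ Unit)) ⊕ τ}
    (hw : w ∈ (rename (Sum.inr : τ → (Fin B × (Fin R ⊕ Unit)) ⊕ τ) q).vars) :
    w ∉ Set.range (fun v : Fin r ⊕ Unit =>
      (Sum.inl (ℓ, Sum.map (Fin.castLE h) id v) : (Fin B × (Fin R ⊕ Unit)) ⊕ τ)) := by
  classical
  intro hmem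
  obtain ⟨x, rfl⟩ := exists_eq_inl_of_mem_range_slot ℓ h hmem
  obtain ⟨v, -, hv⟩ := Finset.mem_image.1 (vars_rename _ _ hw)
  exact Sum.inr_ne_inl hv

/-- Freshness is inherited by sums (two summands). [folklore] -/
private theorem forall_vars_add_of_forall_vars {σ : Type*} {P : σ → Prop} {p q : MvPolynomial σ F}
    (hp : ∀ w ∈ p.vars, P w) (hq : ∀ w ∈ q.vars, P w) : ∀ w ∈ (p + q).vars, P w := by
  classical
  intro w hw
  rcases Finset.mem_union.1 (vars_add_subset p q hw) with h | h
  · exact hp w h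
  · exact hq w h

/-- Freshness is inherited by finite sums. [folklore] -/
private theorem forall_vars_sum_of_forall_vars {σ ι : Type*} {P : σ → Prop} (s : Finset ι)
    (p : ι → MvPolynomial σ F) (hp : ∀ i ∈ s, ∀ w ∈ (p i).vars, P w) :
    ∀ w ∈ (∑ i ∈ s, p i).vars, P w := by
  classical
  intro w hw
  obtain ⟨i, hi, hwi⟩ := Finset.mem_biUnion.1 (vars_sum_subset s p hw)
  exact hp i hi w hwi

/-- **Freshness of a whole stage** (the shape `Ψ_{ℓ+1}(x_m) = Σ_{ℓ' ∈ L} block_{ℓ'}(m) + Φ-part(m)`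
with `ℓ ∉ L`): no seed of `Σ_{ℓ' ∈ L} rename slot_{ℓ'} (p ℓ') + rename inr q` lies in the slot of
block `ℓ` — the `hfresh` hypothesis of `ASSS16.descentFaithful` for the stage maps of the level
recursion. [cite: AgrawalEtAl2011, Cor. 4.3 ("a fresh set of variables")]
locator: paper:arxiv-1111.0582 p0010.txt:L41–L46 -/
theorem stage_fresh (ℓ : Fin B) {r : ℕ} (h : r ≤ R) (L : Finset (Fin B)) (hL : ℓ ∉ L)
    (r' : Fin B → ℕ) (h' : ∀ ℓ', r' ℓ' ≤ R) (p : ∀ ℓ' : Fin B, MvPolynomial (Fin (r' ℓ') ⊕ Unit) F)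
    (q : MvPolynomial τ F) :
    ∀ w ∈ ((∑ ℓ' ∈ L, rename (fun v : Fin (r' ℓ') ⊕ Unit =>
        (Sum.inl (ℓ', Sum.map (Fin.castLE (h' ℓ')) id v) : (Fin B × (Fin R ⊕ Unit)) ⊕ τ)) (p ℓ')) +
      rename (Sum.inr : τ → (Fin B × (Fin R ⊕ Unit)) ⊕ τ) q).vars,
      w ∉ Set.range (fun v : Fin r ⊕ Unit =>
        (Sum.inl (ℓ, Sum.map (Fin.castLE h) id v) : (Fin B × (Fin R ⊕ Unit)) ⊕ τ)) := by
  refine forall_vars_add_of_forall_vars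
    (forall_vars_sum_of_forall_vars L _ fun ℓ' hℓ' w hw => ?_)
    (fun w hw => not_mem_range_slot_of_mem_vars_rename_inr ℓ h q hw)
  exact not_mem_range_slot_of_mem_vars_rename_slot ℓ ℓ' (fun heq => hL (heq ▸ hℓ')) h (h' ℓ')
    (p ℓ') hw

/-! ### The keystone's stage sums `Σ_{ℓ : Fin B, j ≤ ℓ} block_ℓ` -/

/-- **Peeling off block `j`:** `Σ_{j ≤ ℓ} f ℓ = f j + Σ_{j+1 ≤ ℓ} f ℓ` (the stage map of level `j` is
block `j` plus the stage map of level `j + 1` — the shape `Ψ_ℓ = block_ℓ + Ψ_{ℓ+1}` of Cor. 4.3).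
[cite: AgrawalEtAl2011, Cor. 4.3] locator: paper:arxiv-1111.0582 p0010.txt:L41–L46 -/
theorem sum_filter_le_eq_add_sum_filter_succ_le {M : Type*} [AddCommMonoid M] {j : ℕ} (hj : j < B)
    (f : Fin B → M) :
    ∑ ℓ ∈ Finset.univ.filter (fun ℓ : Fin B => j ≤ (ℓ : ℕ)), f ℓ =
      f ⟨j, hj⟩ + ∑ ℓ ∈ Finset.univ.filter (fun ℓ : Fin B => j + 1 ≤ (ℓ : ℕ)), f ℓ := by
  have hset : Finset.univ.filter (fun ℓ : Fin B => j ≤ (ℓ : ℕ)) =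
      insert ⟨j, hj⟩ (Finset.univ.filter (fun ℓ : Fin B => j + 1 ≤ (ℓ : ℕ))) := by
    ext ℓ
    simp only [Finset.mem_filter, Finset.mem_univ, true_and, Finset.mem_insert, Fin.ext_iff]
    omega
  rw [hset, Finset.sum_insert]
  simp only [Finset.mem_filter, Finset.mem_univ, true_and]
  omega

/-- **Past the last block the stage sum is empty** (`j ≥ B`: only the `Φ`-part remains).
[cite: AgrawalEtAl2011, §4, proof of Thm. dDkrPIT (the bottom map `Φ_p`)]
locator: paper:arxiv-1111.0582 p0010.txt:L53–L58 -/
theorem sum_filter_le_eq_zero {M : Type*} [AddCommMonoid M] {j : ℕ} (hj : B ≤ j) (f : Fin B → M) :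
    ∑ ℓ ∈ Finset.univ.filter (fun ℓ : Fin B => j ≤ (ℓ : ℕ)), f ℓ = 0 := by
  have hset : Finset.univ.filter (fun ℓ : Fin B => j ≤ (ℓ : ℕ)) = ∅ := by
    ext ℓ
    simp only [Finset.mem_filter, Finset.mem_univ, true_and, Finset.notMem_empty, iff_false]
    have := ℓ.isLt
    omega
  rw [hset, Finset.sum_empty]

/-- **At `j = 0` the stage sum is the whole generator** (all blocks; the seed layout of
`FSV2018_thm48_topFanIn`). [cite: ForbesShpilkaVolk2018, Construction 46 / Thm. 48 (seq.) = ToC Constr. 5.22 / Thm. 5.24] -/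
theorem sum_filter_zero_le {M : Type*} [AddCommMonoid M] (f : Fin B → M) :
    ∑ ℓ ∈ Finset.univ.filter (fun ℓ : Fin B => 0 ≤ (ℓ : ℕ)), f ℓ = ∑ ℓ, f ℓ := by
  rw [Finset.filter_true_of_mem fun ℓ _ => Nat.zero_le _]

/-- **`hfresh` for the stage map of level `j + 1` against the slot of block `j`** (the instance of
`stage_fresh` the keystone uses: `L = {ℓ : j + 1 ≤ ℓ}` does not contain `j`).
[cite: AgrawalEtAl2011, Cor. 4.3 ("a fresh set of variables")]
locator: paper:arxiv-1111.0582 p0010.txt:L41–L46 -/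
theorem stage_fresh_filter {j : ℕ} (hj : j < B) (r' : Fin B → ℕ) (h' : ∀ ℓ', r' ℓ' ≤ R)
    (p : ∀ ℓ' : Fin B, MvPolynomial (Fin (r' ℓ') ⊕ Unit) F) (q : MvPolynomial τ F) :
    ∀ w ∈ ((∑ ℓ' ∈ Finset.univ.filter (fun ℓ : Fin B => j + 1 ≤ (ℓ : ℕ)),
        rename (fun v : Fin (r' ℓ') ⊕ Unit =>
          (Sum.inl (ℓ', Sum.map (Fin.castLE (h' ℓ')) id v) : (Fin B × (Fin R ⊕ Unit)) ⊕ τ)) (p ℓ')) +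
      rename (Sum.inr : τ → (Fin B × (Fin R ⊕ Unit)) ⊕ τ) q).vars,
      w ∉ Set.range (fun v : Fin (r' ⟨j, hj⟩) ⊕ Unit =>
        (Sum.inl ((⟨j, hj⟩ : Fin B), Sum.map (Fin.castLE (h' ⟨j, hj⟩)) id v) :
          (Fin B × (Fin R ⊕ Unit)) ⊕ τ)) :=
  stage_fresh ⟨j, hj⟩ (h' ⟨j, hj⟩) _ (by simp) r' h' p q

end ASSS16

end Literature.Computability.AlgebraicComplexity

end
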